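import Summits.CriticalPhenomena.Ising3DConformalLimit.Theorems.LogPolarProxyExistsContinuousLimitDoublingSplit
import Summits.CriticalPhenomena.Ising3DConformalLimit.Theorems.ExistsScaleCovariantLimit.Negative.PureExistence
import Summits.CriticalPhenomena.Ising3DConformalLimit.Theorems.ExistsScaleCovariantLimit.Negative.DeltaDetermined
import Summits.CriticalPhenomena.Ising3DConformalLimit.Theorems.MoebiusLimitExists.Negative.OnlyInteractionTightness
import Summits.CriticalPhenomena.Ising3DConformalLimit.Theorems.ConformalPoissonDeviceDeviceWeylUniversalityStubLimitZero
import Literature.Probability.LatticeModels.CriticalTwoPointLawDimension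
import HarnessLib

/-!
# Disproof work file — crux `ExistsContinuousLimit` (item stmt-CriticalPhenomena-4582), cycle 1

Standing crux disprover (`cdisprove`, D-0016) for
`Summit.CriticalPhenomena.Ising3DConformalLimit.Theses.ReflectionTwin.ExistsContinuousLimit`
(route `ReflectionTwin` r4; the SAME term as `LogPolarProxy.ExistsContinuousLimit`, r3). The crux:

`∃ ρ Δ S, (1) ρ > 0 on (0,1] ∧ (2) 0 < Δ ∧ (3) HasPointwiseScalingLimit (criticalCorr 3) ρ S ∧
 (4) S = 0 off NonCoincident ∧ (5) ∀ n, ContinuousOn (S n) (NonCoincident 3 n) ∧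
 (6) IsNondegenerateTwoPoint S ∧ (7) IsTranslationInvariant S ∧ (8) IsScaleCovariant Δ S`.

VERDICT (cycle 1): NOT REFUTED — and not refutable short of refuting the open existence problem itself:
§A shows, kernel-checked, that the crux is EQUIVALENT to the shared existence item stmt-1981
(`HyperoctahedralRP.ExistsScaleCovariantLimit`, landed p146967) and to the bare core
"some full-filter pointwise scaling limit of `criticalCorr 3` has `S₂ ≢ 0`" (Duminil-Copin, ICM 2022,
§8.4 p. 29: "widely open"). The sibling disprover of stmt-1981 (`Cruxes/ExistsScaleCovariantLimit/
Disproof.lean`, 2 cycles) audited every formalisation loophole of that core (`n = 0` gives `S₀ ≡ 1`,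
odd `n` vanish by `m*(β_c) = 0`, `β_c`/`limUnder` states are the true ones, floor cells harmless);
this file does NOT redo that audit — it imports its landed `Negative/` theorems — and adds what is
specific to 4582: the continuity clause (5) and the clause-by-clause load-bearing table.

## Landed this cycle (kernel-checked, ACCEPTED; provers/planners: import these, not this work file)

* p152496 `Theorems/ExistsContinuousLimit/Negative/ContinuityTight.lean` — §C below
  (`ExistsContinuousLimitNegative.two_tendsto_atTop_along_dilations`, `not_continuousAt_two_zero`,
  `not_existsContinuousLimit_everywhereContinuous`, `two_not_bddAbove`,
  `not_existsContinuousLimit_uniformLimit`, `criticalTwoPoint_floor_tendsto_zero`, `not_limitOnUniv`,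
  `not_existsContinuousLimit_limitOnUniv`, `existsContinuousLimit_witness_not_continuousAt_zero`).
* p152614 `Theorems/ExistsContinuousLimit/Negative/LoadBearing.lean` — §A/§B below
  (`existsContinuousLimit_iff_core`, `not_existsContinuousLimit_iff`, the six
  `existsContinuousLimit_iff_without_*`, `hasPointwiseScalingLimit_trivial`,
  `existsContinuousLimit_without_nondeg_holds`, `existsContinuousLimit_without_limit_holds`,
  `existsContinuousLimit_loadBearing`).

## Findings (all sorry-free; no NEAR-MISS this cycle)

* §A `crux_iff_1981`, `crux_iff_core`, `not_crux_iff`: crux ⟺ stmt-1981 ⟺ `Core`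
  (`∃ ρ S, limit ∧ ∃ x ∈ NonCoincident 3 2, S 2 x ≠ 0`). A disproof must show that EVERY pointwise
  scaling limit of the critical `ℤ³` correlators, under ANY renormalisation, has `S₂ ≡ 0`.
* §B LOAD-BEARING TABLE (existential crux: "dropping clause `i`" = the weaker statement `Withoutᵢ`).
  Clauses (1) (2) (4) (5) (7) (8) are IDLE: `withoutᵢ_iff_crux` — each `Withoutᵢ` is still equivalent
  to the crux (they all sit between `Core` and the crux). Clauses (3) and (6) are the ONLY load-bearing
  ones, and each is useless without the other: `withoutLimit_holds` (all clauses but (3) are satisfied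
  by the explicit power family `(∑ᵢⱼ‖xᵢ−xⱼ‖)^{−nΔ}`) and `withoutNondeg_holds` (all clauses but (6) are
  satisfied by the trivial limit `S₀ = 1, Sₙ = 0` of `criticalCorr 3` under `ρ(δ) = δ`). Reading for
  provers: every bit of content is "the limit (3) exists AND is non-zero at one pair (6)".
* §C THE CONTINUITY CLAUSE IS FREE BUT TIGHT. Free: `withoutContinuity_iff_crux` (mesh continuity,
  landed `stub_limitContinuity`; the route docstring's step function `1_{x₁ ≥ 0}` is not translation
  invariant on the lattice, `criticalCorr 3` is). Tight — refuted natural strengthenings, all from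
  (2)+(6)+(8) alone via `S₂(0, c e₀) = c^{−2Δ} S₂(0, e₀) → ∞`:
  `two_tendsto_atTop_along_dilations`, `not_continuousAt_two_diagonal` (NO scale-covariant
  non-degenerate family is continuous at a diagonal point, whatever value it takes there — so (5)
  cannot be upgraded to `Continuous (S n)`: `not_crux_everywhereContinuous`), `two_not_bddAbove`
  (no uniform continuity / boundedness on `NonCoincident`), `not_crux_uniformLimit` ("locally" in (3)
  is load-bearing: uniform convergence on `NonCoincident 3 2` is impossible since the lattice side is
  bounded by `ρ(δ)²`), `not_crux_limitOnUniv` (the restriction to `NonCoincident` in (3) is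
  load-bearing: on the diagonal the rescaled pair correlator is `ρ(δ)² → ∞`, because
  `ρ(δ)²⟨σ₀σ_{⌊1/δ⌋e₀}⟩ → S₂(0,e₀) > 0` while `⟨σ₀σ_{⌊1/δ⌋e₀}⟩ → 0`).
* §D What IS forced on any witness (imported, restated in the 4582 clause shape): `Δ ∈ [1/2, 3/4]`
  (`delta_window`), refuted strengthenings `Δ > 3/4`, `Δ < 1/2`.
* §E Targets / line `registered` (skeleton 2357277d): the single open stub
  `stub_existsScaleCovariantLimit` IS stmt-1981 verbatim (`stub_iff_1981 : … := Iff.rfl`) and the glue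
  `ExistsContinuousLimit_of` is the landed equivalence — joint sufficiency is exact, nothing smuggled,
  no stub weaker than the crux exists to attack (`stuck_stubs = []`).
* §F WHY IT RESISTS (docstring of `resists`): every cheap attack factors through §A; the lattice
  refutation criteria are the sibling's `axis_ratio_tendsto` / `fourPoint_ratio_tendsto` (a log-periodic
  modulation of `⟨σ₀σ_x⟩_{β_c}` on `ℤ³` would refute; only Monte-Carlo evidence, all of it the other way).
-/

noncomputable section

namespace Summit.CriticalPhenomena.Ising3DConformalLimit.Cruxes.ExistsContinuousLimit.Disproof

open Literature.Probability.LatticeModels Filter Set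
open scoped Topology
open Summit.CriticalPhenomena.Ising3DConformalLimit.Theses
open Summit.CriticalPhenomena.Ising3DConformalLimit.LogPolarProxyExistsContinuousLimit
  (reflectionTwin_existsContinuousLimit_iff_existsScaleCovariantLimit)
open Summit.CriticalPhenomena.Ising3DConformalLimit.ExistsScaleCovariantLimitNegative
  (iff_pure_existence delta_mem_Icc_of_witness)
open Summit.CriticalPhenomena.Ising3DConformalLimit.MoebiusLimitExistsNegative
  (tendsto_axisPair rescaledCorrelator_axisPair)
open Summit.CriticalPhenomena.Ising3DConformalLimit.OnlyInteractionTightness (abs_rescaledCorrelator_le)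
open Summit.CriticalPhenomena.Ising3DConformalLimit.Theorems.DeviceWeylUniversality.StubLimitZero
  (rescaledCorrelator_criticalCorr_zero)
open Classical

/-! ## §A  The crux, its alias stmt-1981, and the core -/

/-- The eight clauses of the crux on a triple `(ρ, Δ, S)` (verbatim body of
`ReflectionTwin.ExistsContinuousLimit`). [folklore] -/
def Clauses (ρ : ℝ → ℝ) (Δ : ℝ) (S : CorrFamily 3) : Prop :=
  (∀ δ ∈ Set.Ioc (0:ℝ) 1, 0 < ρ δ) ∧ 0 < Δ ∧ HasPointwiseScalingLimit (criticalCorr 3) ρ S ∧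
    (∀ n z, z ∉ NonCoincident 3 n → S n z = 0) ∧ (∀ n, ContinuousOn (S n) (NonCoincident 3 n)) ∧
      IsNondegenerateTwoPoint S ∧ IsTranslationInvariant S ∧ IsScaleCovariant Δ S

/-- The crux is `∃ ρ Δ S, Clauses ρ Δ S` (definitional). [folklore] -/
theorem crux_iff_clauses :
    ReflectionTwin.ExistsContinuousLimit ↔ ∃ (ρ : ℝ → ℝ) (Δ : ℝ) (S : CorrFamily 3), Clauses ρ Δ S :=
  Iff.rfl

/-- The two route copies are the same term. [folklore] -/
theorem crux_shared : ReflectionTwin.ExistsContinuousLimit ↔ LogPolarProxy.ExistsContinuousLimit :=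
  Iff.rfl

/-- **crux ⟺ stmt-1981** (landed p146967: continuity is free). [folklore] -/
theorem crux_iff_1981 :
    ReflectionTwin.ExistsContinuousLimit ↔ HyperoctahedralRP.ExistsScaleCovariantLimit :=
  reflectionTwin_existsContinuousLimit_iff_existsScaleCovariantLimit

/-- The core of the crux: SOME full-filter pointwise scaling limit of the critical `ℤ³` correlators,
under some renormalisation, is non-zero at one non-coincident pair. [cite: DuminilCopinICM2022, §8.4 p. 29] -/
def Core : Prop :=
  ∃ (ρ : ℝ → ℝ) (S : CorrFamily 3), HasPointwiseScalingLimit (criticalCorr 3) ρ S ∧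
    ∃ x ∈ NonCoincident 3 2, S 2 x ≠ 0

/-- **crux ⟺ Core**: all of (1) (2) (4) (5) (7) (8) and non-degeneracy beyond one pair are
consequences of existence (sibling `PureExistence.iff_pure_existence` composed with the alias). [folklore] -/
theorem crux_iff_core : ReflectionTwin.ExistsContinuousLimit ↔ Core :=
  crux_iff_1981.trans iff_pure_existence

/-- **What a disproof must show**: every pointwise scaling limit of `criticalCorr 3`, under any
renormalisation, vanishes at every non-coincident pair. [folklore] -/
theorem not_crux_iff :
    ¬ ReflectionTwin.ExistsContinuousLimit ↔
      ∀ (ρ : ℝ → ℝ) (S : CorrFamily 3), HasPointwiseScalingLimit (criticalCorr 3) ρ S →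
        ∀ x ∈ NonCoincident 3 2, S 2 x = 0 := by
  rw [crux_iff_core]
  unfold Core
  push Not
  exact Iff.rfl

/-- From the clauses to the core (forgetting). [folklore] -/
theorem core_of_limit_nondeg {ρ : ℝ → ℝ} {S : CorrFamily 3}
    (hlim : HasPointwiseScalingLimit (criticalCorr 3) ρ S) (hnd : IsNondegenerateTwoPoint S) : Core :=
  ⟨ρ, S, hlim, _, zero_unitVec_mem_nonCoincident one_ne_zero,
    (hnd _ (zero_unitVec_mem_nonCoincident one_ne_zero)).ne'⟩

/-! ## §B  Load-bearing table: drop one clause at a time -/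

/-- Crux without (1) `ρ > 0`. [folklore] -/
def WithoutRhoPos : Prop :=
  ∃ (ρ : ℝ → ℝ) (Δ : ℝ) (S : CorrFamily 3), 0 < Δ ∧ HasPointwiseScalingLimit (criticalCorr 3) ρ S ∧
    (∀ n z, z ∉ NonCoincident 3 n → S n z = 0) ∧ (∀ n, ContinuousOn (S n) (NonCoincident 3 n)) ∧
      IsNondegenerateTwoPoint S ∧ IsTranslationInvariant S ∧ IsScaleCovariant Δ S

/-- Crux without (2) `0 < Δ`. [folklore] -/
def WithoutDeltaPos : Prop :=
  ∃ (ρ : ℝ → ℝ) (Δ : ℝ) (S : CorrFamily 3), (∀ δ ∈ Set.Ioc (0:ℝ) 1, 0 < ρ δ) ∧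
    HasPointwiseScalingLimit (criticalCorr 3) ρ S ∧
    (∀ n z, z ∉ NonCoincident 3 n → S n z = 0) ∧ (∀ n, ContinuousOn (S n) (NonCoincident 3 n)) ∧
      IsNondegenerateTwoPoint S ∧ IsTranslationInvariant S ∧ IsScaleCovariant Δ S

/-- Crux without (3), the convergence clause (the triple keeps `ρ`, now unconstrained by any limit). [folklore] -/
def WithoutLimit : Prop :=
  ∃ (ρ : ℝ → ℝ) (Δ : ℝ) (S : CorrFamily 3), (∀ δ ∈ Set.Ioc (0:ℝ) 1, 0 < ρ δ) ∧ 0 < Δ ∧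
    (∀ n z, z ∉ NonCoincident 3 n → S n z = 0) ∧ (∀ n, ContinuousOn (S n) (NonCoincident 3 n)) ∧
      IsNondegenerateTwoPoint S ∧ IsTranslationInvariant S ∧ IsScaleCovariant Δ S

/-- Crux without (4), the normalisation off `NonCoincident`. [folklore] -/
def WithoutNormalisation : Prop :=
  ∃ (ρ : ℝ → ℝ) (Δ : ℝ) (S : CorrFamily 3), (∀ δ ∈ Set.Ioc (0:ℝ) 1, 0 < ρ δ) ∧ 0 < Δ ∧
    HasPointwiseScalingLimit (criticalCorr 3) ρ S ∧ (∀ n, ContinuousOn (S n) (NonCoincident 3 n)) ∧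
      IsNondegenerateTwoPoint S ∧ IsTranslationInvariant S ∧ IsScaleCovariant Δ S

/-- Crux without (5), continuity: this IS stmt-1981 verbatim. [folklore] -/
def WithoutContinuity : Prop :=
  ∃ (ρ : ℝ → ℝ) (Δ : ℝ) (S : CorrFamily 3), (∀ δ ∈ Set.Ioc (0:ℝ) 1, 0 < ρ δ) ∧ 0 < Δ ∧
    HasPointwiseScalingLimit (criticalCorr 3) ρ S ∧ (∀ n z, z ∉ NonCoincident 3 n → S n z = 0) ∧
      IsNondegenerateTwoPoint S ∧ IsTranslationInvariant S ∧ IsScaleCovariant Δ S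

/-- Crux without (6), non-degeneracy. [folklore] -/
def WithoutNondeg : Prop :=
  ∃ (ρ : ℝ → ℝ) (Δ : ℝ) (S : CorrFamily 3), (∀ δ ∈ Set.Ioc (0:ℝ) 1, 0 < ρ δ) ∧ 0 < Δ ∧
    HasPointwiseScalingLimit (criticalCorr 3) ρ S ∧ (∀ n z, z ∉ NonCoincident 3 n → S n z = 0) ∧
      (∀ n, ContinuousOn (S n) (NonCoincident 3 n)) ∧ IsTranslationInvariant S ∧ IsScaleCovariant Δ S

/-- Crux without (7), translation invariance. [folklore] -/
def WithoutTranslation : Prop :=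
  ∃ (ρ : ℝ → ℝ) (Δ : ℝ) (S : CorrFamily 3), (∀ δ ∈ Set.Ioc (0:ℝ) 1, 0 < ρ δ) ∧ 0 < Δ ∧
    HasPointwiseScalingLimit (criticalCorr 3) ρ S ∧ (∀ n z, z ∉ NonCoincident 3 n → S n z = 0) ∧
      (∀ n, ContinuousOn (S n) (NonCoincident 3 n)) ∧ IsNondegenerateTwoPoint S ∧ IsScaleCovariant Δ S

/-- Crux without (8), scale covariance (then `Δ` is idle too). [folklore] -/
def WithoutScale : Prop :=
  ∃ (ρ : ℝ → ℝ) (S : CorrFamily 3), (∀ δ ∈ Set.Ioc (0:ℝ) 1, 0 < ρ δ) ∧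
    HasPointwiseScalingLimit (criticalCorr 3) ρ S ∧ (∀ n z, z ∉ NonCoincident 3 n → S n z = 0) ∧
      (∀ n, ContinuousOn (S n) (NonCoincident 3 n)) ∧ IsNondegenerateTwoPoint S ∧ IsTranslationInvariant S

/-- (1) is idle: `ρ > 0` can always be arranged (odd critical correlators vanish). [folklore] -/
theorem withoutRhoPos_iff_crux : WithoutRhoPos ↔ ReflectionTwin.ExistsContinuousLimit := by
  refine ⟨?_, ?_⟩
  · rintro ⟨ρ, Δ, S, -, hlim, -, -, hnd, -, -⟩
    exact crux_iff_core.2 (core_of_limit_nondeg hlim hnd)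
  · rintro ⟨ρ, Δ, S, -, hΔ, hlim, hz, hc, hnd, htr, hsc⟩
    exact ⟨ρ, Δ, S, hΔ, hlim, hz, hc, hnd, htr, hsc⟩

/-- (2) is idle: `Δ` is an output, forced into `[1/2, 3/4]`. [folklore] -/
theorem withoutDeltaPos_iff_crux : WithoutDeltaPos ↔ ReflectionTwin.ExistsContinuousLimit := by
  refine ⟨?_, ?_⟩
  · rintro ⟨ρ, Δ, S, -, hlim, -, -, hnd, -, -⟩
    exact crux_iff_core.2 (core_of_limit_nondeg hlim hnd)
  · rintro ⟨ρ, Δ, S, hρ, -, hlim, hz, hc, hnd, htr, hsc⟩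
    exact ⟨ρ, Δ, S, hρ, hlim, hz, hc, hnd, htr, hsc⟩

/-- (4) is idle: any witness can be normalised off `NonCoincident`. [folklore] -/
theorem withoutNormalisation_iff_crux : WithoutNormalisation ↔ ReflectionTwin.ExistsContinuousLimit := by
  refine ⟨?_, ?_⟩
  · rintro ⟨ρ, Δ, S, -, -, hlim, -, hnd, -, -⟩
    exact crux_iff_core.2 (core_of_limit_nondeg hlim hnd)
  · rintro ⟨ρ, Δ, S, hρ, hΔ, hlim, -, hc, hnd, htr, hsc⟩
    exact ⟨ρ, Δ, S, hρ, hΔ, hlim, hc, hnd, htr, hsc⟩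

/-- (5) is idle: `WithoutContinuity` is stmt-1981 verbatim and the crux is equivalent to it (mesh
continuity, landed `stub_limitContinuity`). The route docstring's `1_{x₁ ≥ 0}` is a pointwise limit of
ITS OWN discretisation, but that lattice family is not translation invariant; `criticalCorr 3` is. [folklore] -/
theorem withoutContinuity_iff_crux : WithoutContinuity ↔ ReflectionTwin.ExistsContinuousLimit :=
  crux_iff_1981.symm

/-- (7) is idle: translation invariance of any full-filter limit is free. [folklore] -/
theorem withoutTranslation_iff_crux : WithoutTranslation ↔ ReflectionTwin.ExistsContinuousLimit := by
  refine ⟨?_, ?_⟩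
  · rintro ⟨ρ, Δ, S, -, -, hlim, -, -, hnd, -⟩
    exact crux_iff_core.2 (core_of_limit_nondeg hlim hnd)
  · rintro ⟨ρ, Δ, S, hρ, hΔ, hlim, hz, hc, hnd, -, hsc⟩
    exact ⟨ρ, Δ, S, hρ, hΔ, hlim, hz, hc, hnd, hsc⟩

/-- (8) is idle: scale covariance (with some `Δ ∈ [1/2,3/4]`) of any normalised non-degenerate
full-filter limit is free (Messager–Miracle-Solé + Cauchy equation). [folklore] -/
theorem withoutScale_iff_crux : WithoutScale ↔ ReflectionTwin.ExistsContinuousLimit := by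
  refine ⟨?_, ?_⟩
  · rintro ⟨ρ, S, -, hlim, -, -, hnd, -⟩
    exact crux_iff_core.2 (core_of_limit_nondeg hlim hnd)
  · rintro ⟨ρ, Δ, S, hρ, -, hlim, hz, hc, hnd, htr, -⟩
    exact ⟨ρ, S, hρ, hlim, hz, hc, hnd, htr⟩

/-! ### (6) is load-bearing: without non-degeneracy the crux is TRUE, by the trivial limit -/

/-- The trivial family: `S₀ = 1`, `Sₙ = 0` for `n ≥ 1`. [folklore] -/
def trivialFamily : CorrFamily 3 := fun n _ => if n = 0 then 1 else 0

/-- The critical `ℤ³` correlators renormalised by `ρ(δ) = δ` converge to the trivial family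
(`|⟨∏σ⟩| ≤ 1` kills every `n ≥ 1`; `⟨1⟩ = 1` at `n = 0`), even uniformly. [folklore] -/
theorem hasPointwiseScalingLimit_trivialFamily :
    HasPointwiseScalingLimit (criticalCorr 3) (fun δ => δ) trivialFamily := by
  intro n
  refine TendstoUniformlyOn.tendstoLocallyUniformlyOn (Metric.tendstoUniformlyOn_iff.2 fun ε hε => ?_)
  rcases Nat.eq_zero_or_pos n with rfl | hn
  · filter_upwards with δ x _
    rw [rescaledCorrelator_criticalCorr_zero]
    simp [trivialFamily, hε]
  · filter_upwards [Ioo_mem_nhdsGT (show (0:ℝ) < min ε 1 from lt_min hε one_pos)] with δ hδ x _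
    have hδ0 : 0 < δ := hδ.1
    have hδε : δ < ε := lt_of_lt_of_le hδ.2 (min_le_left _ _)
    have hδ1 : δ < 1 := lt_of_lt_of_le hδ.2 (min_le_right _ _)
    have htriv : trivialFamily n x = 0 := by simp [trivialFamily, hn.ne']
    rw [htriv, Real.dist_eq, zero_sub, abs_neg]
    calc |rescaledCorrelator (criticalCorr 3) (fun δ => δ) n δ x| ≤ |δ| ^ n :=
          abs_rescaledCorrelator_le _ n δ x
      _ ≤ |δ| := by
          rw [abs_of_pos hδ0]
          exact pow_le_of_le_one hδ0.le hδ1.le hn.ne'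
      _ < ε := by rwa [abs_of_pos hδ0]

/-- **Without non-degeneracy the crux holds** — witnessed by the genuine (degenerate) scaling limit of
`criticalCorr 3` under `ρ(δ) = δ`. So clause (6) is load-bearing: together with (3) it carries ALL the
content. [folklore] -/
theorem withoutNondeg_holds : WithoutNondeg := by
  refine ⟨fun δ => δ, 1, trivialFamily, fun δ hδ => hδ.1, one_pos,
    hasPointwiseScalingLimit_trivialFamily, ?_, ?_, ?_, ?_⟩
  · intro n z hz
    rcases Nat.eq_zero_or_pos n with rfl | hn
    · exact absurd (Function.injective_of_subsingleton z) hz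
    · simp [trivialFamily, hn.ne']
  · intro n
    exact continuousOn_const
  · intro n v x
    rfl
  · intro n c hc x
    rcases Nat.eq_zero_or_pos n with rfl | hn
    · simp [trivialFamily]
    · simp [trivialFamily, hn.ne']

/-! ### (3) is load-bearing: without the convergence clause the crux is TRUE, by a power family -/

/-- Total pairwise distance `D(x) = ∑ᵢ ∑ⱼ ‖xᵢ − xⱼ‖` of a configuration. [folklore] -/
def pairDist {n : ℕ} (x : Fin n → EuclideanSpace ℝ (Fin 3)) : ℝ := ∑ i, ∑ j, ‖x i - x j‖

theorem pairDist_nonneg {n : ℕ} (x : Fin n → EuclideanSpace ℝ (Fin 3)) : 0 ≤ pairDist x :=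
  Finset.sum_nonneg fun _ _ => Finset.sum_nonneg fun _ _ => norm_nonneg _

theorem pairDist_translate {n : ℕ} (v : EuclideanSpace ℝ (Fin 3)) (x : Fin n → EuclideanSpace ℝ (Fin 3)) :
    pairDist (fun i => x i + v) = pairDist x := by
  simp [pairDist, add_sub_add_right_eq_sub]

theorem pairDist_smul {n : ℕ} {c : ℝ} (hc : 0 < c) (x : Fin n → EuclideanSpace ℝ (Fin 3)) :
    pairDist (fun i => c • x i) = c * pairDist x := by
  simp only [pairDist, ← smul_sub, norm_smul, Real.norm_eq_abs, abs_of_pos hc, Finset.mul_sum]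

/-- On a non-coincident configuration with `n ≥ 2` points the total pairwise distance is positive. [folklore] -/
theorem pairDist_pos {n : ℕ} (hn : 2 ≤ n) {x : Fin n → EuclideanSpace ℝ (Fin 3)}
    (hx : x ∈ NonCoincident 3 n) : 0 < pairDist x := by
  obtain ⟨k, rfl⟩ : ∃ k, n = k + 2 := ⟨n - 2, by omega⟩
  rw [mem_nonCoincident] at hx
  have hij : (0 : Fin (k + 2)) ≠ 1 := Fin.zero_ne_one
  have hne : x 0 ≠ x 1 := fun h => hij (hx h)
  have hpos : 0 < ‖x 0 - x 1‖ := norm_pos_iff.2 (sub_ne_zero.2 hne)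
  have h1 : ‖x 0 - x 1‖ ≤ ∑ j, ‖x 0 - x j‖ :=
    Finset.single_le_sum (f := fun j => ‖x 0 - x j‖) (fun _ _ => norm_nonneg _) (Finset.mem_univ 1)
  have h2 : ∑ j, ‖x 0 - x j‖ ≤ pairDist x :=
    Finset.single_le_sum (f := fun i => ∑ j, ‖x i - x j‖)
      (fun _ _ => Finset.sum_nonneg fun _ _ => norm_nonneg _) (Finset.mem_univ 0)
  exact hpos.trans_le (h1.trans h2)

theorem continuous_pairDist {n : ℕ} : Continuous (pairDist : (Fin n → EuclideanSpace ℝ (Fin 3)) → ℝ) :=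
  continuous_finsetSum _ fun i _ => continuous_finsetSum _ fun j _ =>
    ((continuous_apply i).sub (continuous_apply j)).norm

/-- The power family `Sₙ(x) = D(x)^{−nΔ}` on `NonCoincident`, `0` elsewhere. [folklore] -/
def powerFamily (Δ : ℝ) : CorrFamily 3 := fun n x =>
  if x ∈ NonCoincident 3 n then pairDist x ^ (-(n : ℝ) * Δ) else 0

/-- Membership in `NonCoincident` is translation invariant. [folklore] -/
theorem mem_nonCoincident_translate {n : ℕ} (v : EuclideanSpace ℝ (Fin 3)) (x : Fin n → EuclideanSpace ℝ (Fin 3)) :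
    (fun i => x i + v) ∈ NonCoincident 3 n ↔ x ∈ NonCoincident 3 n := by
  simp only [mem_nonCoincident]
  exact ⟨fun h i j hij => h (by simp [hij]), fun h i j hij => h (add_right_cancel hij)⟩

/-- Membership in `NonCoincident` is dilation invariant (`c ≠ 0`). [folklore] -/
theorem mem_nonCoincident_smul {n : ℕ} {c : ℝ} (hc : c ≠ 0) (x : Fin n → EuclideanSpace ℝ (Fin 3)) :
    (fun i => c • x i) ∈ NonCoincident 3 n ↔ x ∈ NonCoincident 3 n := by
  simp only [mem_nonCoincident]
  exact ⟨fun h i j hij => h (by simp [hij]), fun h i j hij => h (smul_right_injective _ hc hij)⟩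

/-- **Without the convergence clause the crux holds**: the power family satisfies every other clause
(with `ρ ≡ 1`, any `Δ > 0`). So clause (3) is load-bearing, and the non-limit clauses are mutually
consistent (a non-junk model of the clause bundle). [folklore] -/
theorem withoutLimit_holds : WithoutLimit := by
  refine ⟨fun _ => 1, 1, powerFamily 1, fun _ _ => one_pos, one_pos, ?_, ?_, ?_, ?_, ?_⟩
  · intro n z hz
    simp [powerFamily, hz]
  · intro n
    have hcont : ContinuousOn (fun x : Fin n → EuclideanSpace ℝ (Fin 3) => pairDist x ^ (-(n : ℝ) * 1))
        (NonCoincident 3 n) := by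
      rcases lt_or_ge n 2 with hn | hn
      · -- `n ≤ 1`: `pairDist ≡ 0`, the function is constant
        have h0 : ∀ x : Fin n → EuclideanSpace ℝ (Fin 3), pairDist x = 0 := by
          intro x
          interval_cases n <;> simp [pairDist]
        simp_rw [h0]
        exact continuousOn_const
      · exact continuous_pairDist.continuousOn.rpow_const fun x hx => Or.inl (pairDist_pos hn hx).ne'
    refine hcont.congr fun x hx => ?_
    simp [powerFamily, hx]
  · intro x hx
    simp only [powerFamily, if_pos hx]
    exact Real.rpow_pos_of_pos (pairDist_pos le_rfl hx) _
  · intro n v x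
    simp only [powerFamily, mem_nonCoincident_translate, pairDist_translate]
  · intro n c hc x
    simp only [powerFamily, mem_nonCoincident_smul hc.ne', pairDist_smul hc]
    split_ifs with hx
    · rw [Real.mul_rpow hc.le (pairDist_nonneg x)]
    · exact (mul_zero _).symm

/-! ## §C  The continuity clause: free (§B) but TIGHT — refuted strengthenings -/

/-- The axis pair `(0, t e₀)`. [folklore] -/
def axisCfg (t : ℝ) : Fin 2 → EuclideanSpace ℝ (Fin 3) := ![0, EuclideanSpace.single 0 t]

theorem axisCfg_smul (c t : ℝ) : (fun i => c • axisCfg t i) = axisCfg (c * t) := by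
  funext i
  fin_cases i
  · simp [axisCfg]
  · simp only [axisCfg, Fin.mk_one, Matrix.cons_val_one, Matrix.cons_val_fin_one]
    ext j
    by_cases hj : j = 0
    · subst hj; simp
    · simp [hj]

theorem axisCfg_zero : axisCfg 0 = fun _ => 0 := by
  funext i
  fin_cases i
  · simp [axisCfg]
  · simp [axisCfg]

theorem axisCfg_zero_not_mem : axisCfg 0 ∉ NonCoincident 3 2 := by
  rw [axisCfg_zero, mem_nonCoincident]
  intro h
  exact absurd (@h 0 1 rfl) (by decide)

/-- Scale covariance read at the axis pair: `S₂(0, c e₀) = c^{−2Δ} S₂(0, e₀)`. [folklore] -/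
theorem two_axisCfg_eq {Δ : ℝ} {S : CorrFamily 3} (hsc : IsScaleCovariant Δ S) {c : ℝ} (hc : 0 < c) :
    S 2 (axisCfg c) = c ^ (-(2 * Δ)) * S 2 (axisCfg 1) := by
  have h := hsc 2 c hc (axisCfg 1)
  rw [axisCfg_smul, mul_one] at h
  rw [h]
  norm_num

/-- **The two-point function of ANY scale-covariant (`Δ > 0`) family positive at `(0,e₀)` blows up along
the dilations `c → 0⁺` of that pair.** [folklore] -/
theorem two_tendsto_atTop_along_dilations {Δ : ℝ} {S : CorrFamily 3} (hΔ : 0 < Δ)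
    (hsc : IsScaleCovariant Δ S) (hpos : 0 < S 2 (axisCfg 1)) :
    Tendsto (fun c => S 2 (axisCfg c)) (𝓝[>] (0:ℝ)) atTop := by
  have hpow : Tendsto (fun c : ℝ => c ^ (-(2 * Δ))) (𝓝[>] (0:ℝ)) atTop := by
    have h := (tendsto_rpow_atTop (by positivity : 0 < 2 * Δ)).comp tendsto_inv_nhdsGT_zero
    refine h.congr' ?_
    filter_upwards [self_mem_nhdsWithin] with c hc
    simp only [Function.comp_apply]
    rw [Real.inv_rpow (le_of_lt hc), Real.rpow_neg (le_of_lt hc)]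
  have h := hpow.atTop_mul_const hpos
  refine h.congr' ?_
  filter_upwards [self_mem_nhdsWithin] with c hc
  exact (two_axisCfg_eq hsc hc).symm

/-- **No scale-covariant (`Δ > 0`) family with `S₂(0,e₀) > 0` is continuous at the diagonal point
`(0,0)`** — whatever value it takes there. Hence clause (5) cannot be strengthened to
`Continuous (S 2)`: the restriction to `NonCoincident` is forced by (2)+(6)+(8) alone. [folklore] -/
theorem not_continuousAt_two_diagonal {Δ : ℝ} {S : CorrFamily 3} (hΔ : 0 < Δ)
    (hsc : IsScaleCovariant Δ S) (hpos : 0 < S 2 (axisCfg 1)) :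
    ¬ ContinuousAt (S 2) (axisCfg 0) := by
  intro hcont
  have hg : Continuous fun c : ℝ => axisCfg c := by
    have : (fun c : ℝ => axisCfg c) = fun c => fun i => c • axisCfg 1 i := by
      funext c; rw [axisCfg_smul, mul_one]
    rw [this]
    fun_prop
  have h1 : Tendsto (fun c => S 2 (axisCfg c)) (𝓝[>] (0:ℝ)) (𝓝 (S 2 (axisCfg 0))) :=
    ((hcont.tendsto.comp (hg.tendsto 0)).mono_left nhdsWithin_le_nhds)
  exact not_tendsto_nhds_of_tendsto_atTop (two_tendsto_atTop_along_dilations hΔ hsc hpos) _ h1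

/-- REFUTED STRENGTHENING (continuity everywhere): no triple satisfies the clauses with (5) upgraded
to `∀ n, Continuous (S n)` — indeed not even (2)+(6)+(8) together with continuity of `S 2` at one
diagonal point. [folklore] -/
theorem not_crux_everywhereContinuous :
    ¬ ∃ (ρ : ℝ → ℝ) (Δ : ℝ) (S : CorrFamily 3), (∀ δ ∈ Set.Ioc (0:ℝ) 1, 0 < ρ δ) ∧ 0 < Δ ∧
      HasPointwiseScalingLimit (criticalCorr 3) ρ S ∧ (∀ n z, z ∉ NonCoincident 3 n → S n z = 0) ∧
      (∀ n, Continuous (S n)) ∧ IsNondegenerateTwoPoint S ∧ IsTranslationInvariant S ∧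
      IsScaleCovariant Δ S := by
  rintro ⟨ρ, Δ, S, -, hΔ, -, -, hcont, hnd, -, hsc⟩
  exact not_continuousAt_two_diagonal hΔ hsc (hnd _ (zero_unitVec_mem_nonCoincident one_ne_zero))
    (hcont 2).continuousAt

/-- `S₂` of a scale-covariant non-degenerate family is unbounded above on `NonCoincident 3 2`
(so (5) cannot be upgraded to uniform continuity or boundedness off the diagonal either). [folklore] -/
theorem two_not_bddAbove {Δ : ℝ} {S : CorrFamily 3} (hΔ : 0 < Δ) (hsc : IsScaleCovariant Δ S)
    (hpos : 0 < S 2 (axisCfg 1)) (M : ℝ) : ∃ x ∈ NonCoincident 3 2, M < S 2 x := by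
  have h := (two_tendsto_atTop_along_dilations hΔ hsc hpos).eventually_gt_atTop M
  obtain ⟨c, hcM, hc⟩ := (h.and self_mem_nhdsWithin).exists
  exact ⟨axisCfg c, zero_unitVec_mem_nonCoincident (ne_of_gt hc), hcM⟩

/-- REFUTED STRENGTHENING ("locally" is load-bearing in (3)): the convergence cannot be UNIFORM on
`NonCoincident 3 2` — at a fixed mesh the rescaled pair correlator is bounded by `ρ(δ)²`
(`|⟨σσ⟩| ≤ 1`) while the limit is unbounded. Only (2)+(6)+(8) of the limit are used. [folklore] -/
theorem not_crux_uniformLimit :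
    ¬ ∃ (ρ : ℝ → ℝ) (Δ : ℝ) (S : CorrFamily 3), 0 < Δ ∧
      TendstoUniformlyOn (rescaledCorrelator (criticalCorr 3) ρ 2) (S 2) (𝓝[>] (0:ℝ)) (NonCoincident 3 2) ∧
      IsNondegenerateTwoPoint S ∧ IsScaleCovariant Δ S := by
  rintro ⟨ρ, Δ, S, hΔ, hU, hnd, hsc⟩
  have h1 := (Metric.tendstoUniformlyOn_iff.1 hU) 1 one_pos
  obtain ⟨δ, hδ⟩ := h1.exists
  obtain ⟨x, hx, hMx⟩ := two_not_bddAbove hΔ hsc (hnd _ (zero_unitVec_mem_nonCoincident one_ne_zero))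
    (|ρ δ| ^ 2 + 1)
  have hd := hδ x hx
  rw [Real.dist_eq] at hd
  have hb := abs_rescaledCorrelator_le ρ 2 δ x
  have : S 2 x < |ρ δ| ^ 2 + 1 := by
    have := abs_sub_lt_iff.1 hd
    linarith [le_abs_self (rescaledCorrelator (criticalCorr 3) ρ 2 δ x)]
  linarith

/-- `⟨σ₀ σ_{⌊1/δ⌋ e₀}⟩_{β_c} → 0` as `δ → 0⁺` (infrared decay along the axis). [folklore] -/
theorem criticalTwoPoint_floor_tendsto_zero :
    Tendsto (fun δ : ℝ => criticalTwoPoint 3 (Pi.single (0 : Fin 3) ⌊1 / δ⌋)) (𝓝[>] (0:ℝ)) (𝓝 0) := by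
  have hinv : Tendsto (fun δ : ℝ => 1 / δ) (𝓝[>] (0:ℝ)) atTop := by
    simpa only [one_div] using tendsto_inv_nhdsGT_zero
  have hfl : Tendsto (fun δ : ℝ => ⌊1 / δ⌋) (𝓝[>] (0:ℝ)) atTop :=
    (tendsto_floor_atTop (α := ℝ)).comp hinv
  have hsingle : Tendsto (fun m : ℤ => (Pi.single (0 : Fin 3) m : Site 3)) cofinite cofinite :=
    (Pi.single_injective (M := fun _ : Fin 3 => ℤ) (0 : Fin 3)).tendsto_cofinite
  exact criticalTwoPoint_tendsto_zero_cofinite.comp (hsingle.comp (hfl.mono_right atTop_le_cofinite))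

/-- **The restriction to `NonCoincident` in (3) is load-bearing**: the rescaled pair correlator cannot
converge locally uniformly on ALL of `(ℝ³)²` to a family non-degenerate at `(0,e₀)` — on the diagonal it
equals `ρ(δ)²` (`σ² = 1`), which would have to converge, while `ρ(δ)² ⟨σ₀σ_{⌊1/δ⌋e₀}⟩ → S₂(0,e₀) > 0`
forces `ρ(δ)² → ∞` by the infrared decay of the critical two-point function. [folklore] -/
theorem not_limitOnUniv {ρ : ℝ → ℝ} {S : CorrFamily 3}
    (hU : TendstoLocallyUniformlyOn (rescaledCorrelator (criticalCorr 3) ρ 2) (S 2) (𝓝[>] (0:ℝ)) univ)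
    (hpos : 0 < S 2 (axisCfg 1)) : False := by
  -- at the diagonal point `(0, 0·e₀)`: `ρ(δ)² → S₂(0,0)`
  have h0 := hU.tendsto_at (mem_univ (axisCfg 0))
  have h0' : Tendsto (fun δ => ρ δ ^ 2) (𝓝[>] (0:ℝ)) (𝓝 (S 2 (axisCfg 0))) := by
    refine h0.congr fun δ => ?_
    rw [show axisCfg 0 = ![0, EuclideanSpace.single 0 (0:ℝ)] from rfl, rescaledCorrelator_axisPair]
    simp [criticalTwoPoint_zero']
  -- at the unit axis pair: `ρ(δ)² ⟨σ₀σ_{⌊1/δ⌋e₀}⟩ → S₂(0,e₀)`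
  have h1 := hU.tendsto_at (mem_univ (axisCfg 1))
  have h1' : Tendsto (fun δ => ρ δ ^ 2 * criticalTwoPoint 3 (Pi.single (0 : Fin 3) ⌊1 / δ⌋))
      (𝓝[>] (0:ℝ)) (𝓝 (S 2 (axisCfg 1))) := by
    refine h1.congr fun δ => ?_
    rw [show axisCfg 1 = ![0, EuclideanSpace.single 0 (1:ℝ)] from rfl, rescaledCorrelator_axisPair]
  have h2 := h0'.mul criticalTwoPoint_floor_tendsto_zero
  rw [mul_zero] at h2
  have := tendsto_nhds_unique h1' h2
  linarith

/-- REFUTED STRENGTHENING (limit on all of `(ℝ³)ⁿ`): no renormalisation makes the critical correlators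
converge locally uniformly EVERYWHERE to a non-degenerate family. [folklore] -/
theorem not_crux_limitOnUniv :
    ¬ ∃ (ρ : ℝ → ℝ) (S : CorrFamily 3),
      (∀ n, TendstoLocallyUniformlyOn (rescaledCorrelator (criticalCorr 3) ρ n) (S n) (𝓝[>] (0:ℝ)) univ) ∧
      IsNondegenerateTwoPoint S := by
  rintro ⟨ρ, S, hU, hnd⟩
  exact not_limitOnUniv (hU 2) (hnd _ (zero_unitVec_mem_nonCoincident one_ne_zero))

/-! ## §D  What IS forced on a witness (imported from the sibling crux, 4582 clause shape) -/

/-- Every witness of the crux has `Δ ∈ [1/2, 3/4]`. [cite: DuminilCopinPanis2025LowerBounds, Theorem 1.5] -/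
theorem delta_window {ρ : ℝ → ℝ} {Δ : ℝ} {S : CorrFamily 3} (h : Clauses ρ Δ S) :
    Δ ∈ Set.Icc (1/2 : ℝ) (3/4) :=
  delta_mem_Icc_of_witness h.1 h.2.2.1 h.2.2.2.2.2.1 h.2.2.2.2.2.2.2

/-- REFUTED STRENGTHENING: no witness with `3/4 < Δ` (Duminil-Copin–Panis 2025; the free-field value
`Δ = 1/2` is NOT excluded — only `η ≥ 0` is rigorous). [cite: DuminilCopinPanis2025LowerBounds, Theorem 1.5] -/
theorem not_crux_with_delta_gt_threeQuarters :
    ¬ ∃ (ρ : ℝ → ℝ) (Δ : ℝ) (S : CorrFamily 3), Clauses ρ Δ S ∧ 3/4 < Δ := by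
  rintro ⟨ρ, Δ, S, h, hΔ⟩
  exact absurd (delta_window h).2 (not_le.2 hΔ)

/-- REFUTED STRENGTHENING: no witness with `Δ < 1/2` (Simon–Lieb). [cite: Simon1980, Thm. 1] -/
theorem not_crux_with_delta_lt_half :
    ¬ ∃ (ρ : ℝ → ℝ) (Δ : ℝ) (S : CorrFamily 3), Clauses ρ Δ S ∧ Δ < 1/2 := by
  rintro ⟨ρ, Δ, S, h, hΔ⟩
  exact absurd (delta_window h).1 (not_le.2 hΔ)

/-! ## §E  Targets / line `registered` -/

/-- The single open stub of skeleton 2357277d is stmt-1981 VERBATIM; the glue is `crux_iff_1981` —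
joint sufficiency is exact, nothing is smuggled, and there is no stub weaker than the crux to attack. [folklore] -/
theorem stub_iff_1981 :
    (∃ (ρ : ℝ → ℝ) (Δ : ℝ) (S : Literature.Probability.LatticeModels.CorrFamily 3),
      (∀ δ ∈ Set.Ioc (0:ℝ) 1, 0 < ρ δ) ∧ 0 < Δ ∧
      Literature.Probability.LatticeModels.HasPointwiseScalingLimit
        (Literature.Probability.LatticeModels.criticalCorr 3) ρ S ∧
      (∀ n z, z ∉ Literature.Probability.LatticeModels.NonCoincident 3 n → S n z = 0) ∧
      Literature.Probability.LatticeModels.IsNondegenerateTwoPoint S ∧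
      Literature.Probability.LatticeModels.IsTranslationInvariant S ∧
      Literature.Probability.LatticeModels.IsScaleCovariant Δ S) ↔
    HyperoctahedralRP.ExistsScaleCovariantLimit :=
  Iff.rfl

/-! ## §F  Why it resists -/

/-- WHY THE CRUX RESISTS (cycle 1). Every cheap attack factors through `crux_iff_core`: to refute one
must prove that EVERY renormalised full-filter limit of the critical `ℤ³` spin correlators has `S₂ ≡ 0`,
i.e. refute the existence half of the conjunct itself (open, ICM 2022 §8.4). No junk instance survives:
`n = 0` (`S₀ ≡ 1`, consistent with (4)/(8) since `c^0 = 1` and `Fin 0`-configurations are injective),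
odd `n` (vanish), the diagonal (excluded by (4), and §C shows it MUST be excluded), the floor cells
(mesh continuity + free translations). The lattice-side refutation criteria remain the sibling's
`axis_ratio_tendsto` (regular variation of `⟨σ₀σ_{me₀}⟩` in `m`) and `fourPoint_ratio_tendsto`; the only
conceivable counter-scenario — a log-periodic modulation (discrete scale invariance) of the critical
two-point function on `ℤ³` — is consistent with everything rigorous (`c‖x‖⁻² ≤ G ≤ C‖x‖⁻¹`, MMS
monotonicity, RP) per the sibling's §E, but has no support (bootstrap/MC: a single `Δ_σ ≈ 0.5181`).
This theorem merely records the reading; its content is `crux_iff_core`. [folklore] -/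
theorem resists : (ReflectionTwin.ExistsContinuousLimit ↔ Core) ∧ WithoutLimit ∧ WithoutNondeg :=
  ⟨crux_iff_core, withoutLimit_holds, withoutNondeg_holds⟩

end Summit.CriticalPhenomena.Ising3DConformalLimit.Cruxes.ExistsContinuousLimit.Disproof

end
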